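import Literature.MathematicalPhysics.PowerSystems.KronReductionQuotientProperty
import Literature.MathematicalPhysics.PowerSystems.KronReductionEffectiveResistance
import HarnessLib

/-!
# Uniform effective resistances among the boundary nodes ⟺ uniform complete Kron-reduced network,
# `r = 2/(|α| a)` (Dörfler–Bullo 2013, Theorem 3.12, loop-less case) — electrically uniform
# generator sets reduce EXACTLY to the all-to-all uniformly coupled model

Topic `Literature/MathematicalPhysics/PowerSystems`; namespaces `…PowerSystems.KronReduction` (§1
harmonic vectors and grounded solves, §2 Theorem 3.12 1) ⇒ 2), §3 Theorem 3.12 2) ⇒ 1)) and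
`…PowerSystems.ClassicalModel` (§4).  Sixth file of the Dörfler–Bullo Kron-reduction story; uses
`KronReductionClosure` (Laplacian package of a reduction, `interiorBlock_posDef_of_laplacian`,
`kronReduced_connected`), `KronReductionEffectiveResistance` (two terminals:
`−L_red[a,z] = 1/𝓡(a ↔ z)`, `isIrreducible_networkKernel_of_connected`) and
`KronReductionQuotientProperty` (`kronReduced_kronReduced`).  Everything below is PROVED: 0
definitions, 0 named facts, 0 `sorry`, no new axiom.

SOURCES (read on the page).  `lit read paper:arxiv-1102.2950` = [DorflerBullo2013] §3.3
**Theorem 3.12 (Equivalence of Uniformity in Effective Resistance and Kron Reduction)** (p0018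
L53–L64): «Loop-less case: Let `R` be the matrix of effective resistances. Then the following two
statements are equivalent: 1) The effective resistances among the boundary nodes `α` are uniform,
i.e., there is `r > 0` such that `R_ij = r` for all distinct `i,j ∈ α`; 2) The weighting of the edges
in the Kron-reduced network is uniform, i.e., there is `a > 0` such that `A_red[i,j] = a > 0` for
all distinct `i,j ∈ α`. If both statements 1) and 2) are true, then it holds that `r = 2/(|α| a)`»;
Remark 3.13 (p0019 L5–L8): «The assumption of uniform effective resistances … is by no means
artificial but rather corresponds to an ideal network, where all boundary [nodes] are electrically
uniformly distributed … uniform resistances among a set of boundary nodes occur for various graph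
topologies»; proof (p0019 L80): «Given these formulas [Thm 3.9, Lemma 3.11 3), Lemma 3.14], the
proof … reduces to mere computation. For the sake of brevity, it will be omitted»; §1 (p0003
L38–L53): «the reduced current-balances `I_α + Q_ac I_β = Q_red V_α` … In case that `I_β` is the
vector of zeros, the `(i,j)`-element of `Q_red` is the current at boundary node `i` due to a unit
potential at boundary node `j` and a zero potential at all other boundary nodes»; §2.6 (p0010
L57–L68): «if the effective resistance among all generators takes the uniform value `R` … the
results of this paper render the element-wise condition on `|α| min_{i≠j}{P_ij}` in the reduced
network to a resistive synchronization condition in the non-reduced network: `1/R > max_{i,j}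
{ω_i − ω_j}·1/(2V²) + max_i {A_red[i,i]}` … bridge the gap … to the synchronization analysis in
complex networks depending on … the effective conductance `1/R`».

RENDERING.  Predicate form (`Q : Matrix ι ι ℝ`, boundary `{i // q i}`, two-terminal boundaries
`{i // i = a ∨ i = b}`, `Q_red = Q_αα − Q_αβQ_ββ⁻¹Q_βα` spelled out).  The effective resistance
between boundary nodes enters through the TWO-TERMINAL Kron reduction: for a connected loop-less
network `−(Q/Q({a,b}ᶜ))_{ab} = 1/R_ab` (`neg_kronReduced_pair_eq_effectiveConductance`, Levin–Peres
/ Lyons–Peres `effectiveResistance`); §2–§3 are stated with a uniform two-terminal coupling `κ`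
(= `1/r`), §4 translates to `effectiveResistance`.  HYPOTHESES: `Q` symmetric, `Q_ij ≤ 0` off the
diagonal, ZERO row sums (loop-less), connected graph of the non-zero entries.

WHAT IS PROVED (0 `def`, 0 named facts, 0 `sorry`):
* §1 ★★ **`kronReduced_mulVec_of_harmonic`** — the reduced matrix acts on the boundary values of
  any vector without interior current injections: `(Qz)_β = 0 ⇒ (Q_red z|α)_a = (Qz)_a` (only `Q`
  symmetric with `Q_ββ ≻ 0`); a private grounded solve (`v_c = 0`, `(Qv)_i = w_i` off `c`,
  Kirchhoff at `c`).
* §2 ★ `kronReduced_congr` (pointwise-equivalent boundary predicates give the same reduction,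
  re-indexed); ★★★ **`kronReduced_offDiag_eq_of_pairCoupling_eq`** — THM 3.12 loop-less 1) ⇒ 2): if
  every two-terminal reduction onto a pair of boundary nodes has mutual entry `−κ`, every mutual
  entry of `Q_red` is `−2κ/|α|`.
* §3 ★★ `pairCoupling_of_offDiag_eq` (a uniform complete Laplacian with mutual entries `−a` on `n`
  nodes has two-terminal couplings `n a/2`); ★★★ **`pairCoupling_eq_of_kronReduced_offDiag_eq`** —
  THM 3.12 loop-less 2) ⇒ 1).
* §4 THE MODEL (`ClassicalModel`; conductance network `c` = line susceptances, no shunts, bus graph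
  connected, `B = diag(c(x)) − c`, generators `A`): ★★★
  **`kronCoupling_eq_of_effectiveResistance_eq`** (all generator pairs have effective reactance
  `r` ⇒ every network-reduced coupling equals `|V_a||V_z|·2/(|A| r)`: the network-reduced classical
  model is the COMPLETE graph with UNIFORM weights), ★★★
  **`effectiveResistance_eq_of_kronCoupling_eq`** (conversely uniform couplings `w` ⇒ all effective
  reactances `2/(|A| w)`).

PROOF ROUTE (not the source's, which inverts `Q_red` through the resistance matrix and
pseudo-inverses, Lemmas 3.10–3.11, 3.14).  1) ⇒ 2): for boundary `a ≠ b` pick a third boundary node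
`c` (if `α = {a,b}` the claim is the hypothesis) and GROUND it: `G = (Q_red)_c⁻¹` (positive definite
block).  For `u ≠ c` the grounded potential `v = G e_u` (resp. `G(e_u − e_v)`) has no current
injection off `{u, c}` (resp. `{u, v}`), so the two-terminal reduction of `Q_red` — which is the
two-terminal reduction of `Q` by the quotient property — acts on its boundary values (§1), giving
`κ G_uu = 1` and `κ(G_uu + G_vv − 2G_uv) = 1`; hence `G = (I + J)/(2κ)` and `(Q_red)_c(I + J) =
2κI`, i.e. all mutual entries of a row of `Q_red` coincide and exceed the diagonal by `−2κ`; the zero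
row sum gives `−2κ/|α|`.  2) ⇒ 1): on the uniform complete network `e_u − e_t` is harmonic off
`{u, t}` and `(M(e_u − e_t))_u = n a`.  In-seat exact cross-check
(`negtest/kron_uniform_check.py`, python `Fraction`s, seat folder): stars, complete bipartite and
complete networks with uniform boundary resistances (1) ⇒ 2) and `r = 2/(|α| a)`), uniform complete
matrices (2) ⇒ 1)), and the §1 identities on random networks — all pass.

THREE COLUMNS.  CERTIFIED (kernel theorems): for exact data and a connected loop-less Laplacian,
uniform two-terminal couplings `κ` on a boundary set `α` ⟺ uniform complete Kron reduction with
mutual entries `−2κ/|α|`; for a shunt-free conductance network: uniform effective resistance `r`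
among the nodes of `A` ⟺ uniform Kron-reduced couplings `2/(|A| r)`.  MODELLED: lossless
shunt-free network, classical machines as boundary nodes, `|V|` fixed (D–B §2.6).  NOT CLAIMED: the
strictly loopy case 3) ⟺ 4) of Theorem 3.12 (augmented Laplacian, `g`), Lemmas 3.10–3.11 /
Theorems 3.13–3.16 (resistance matrix ↔ `Q_red†`), the resistive synchronization condition itself
(that needs the element-wise sync theorem), lossy networks, dynamics.

## References
* [DorflerBullo2013] F. Dörfler, F. Bullo, *Kron reduction of graphs with applications to
  electrical networks*, IEEE Trans. Circuits Syst. I 60 (2013) 150–163,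
  doi:10.1109/tcsi.2012.2215780, arXiv:1102.2950 — §3.3 Theorem 3.12, Remark 3.13; §1; §2.6.
* [LevinPeres2017] / [LyonsPeres2016] — effective resistance (through
  `KronReductionEffectiveResistance` and `Literature/Probability/MarkovChains`).
-/

noncomputable section

open scoped Matrix
open Finset Matrix

namespace Literature.MathematicalPhysics.PowerSystems

namespace KronReduction

/-! ### §1. The Kron reduction acts on the boundary data of harmonic vectors; grounded solves -/

section Harmonic

variable {ι : Type*} [Fintype ι] [DecidableEq ι]

omit [Fintype ι] [DecidableEq ι] in
/-- Symmetric entries. [folklore] -/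
private theorem entry_symm₅ {Q : Matrix ι ι ℝ} (hQ : Q.IsHermitian) (i j : ι) : Q j i = Q i j := by
  simpa only [star_trivial] using hQ.apply i j

omit [Fintype ι] [DecidableEq ι] in
/-- The lower-left block is the transpose of the upper-right one. [folklore] -/
private theorem submatrix_swap_eq_transpose₅ (p : ι → Prop) {Q : Matrix ι ι ℝ}
    (hQ : Q.IsHermitian) :
    Q.submatrix (Subtype.val : {v : ι // ¬ (p v)} → ι) (Subtype.val : {v : ι // p v} → ι) = (Q.submatrix (Subtype.val : {v : ι // p v} → ι) (Subtype.val : {v : ι // ¬ (p v)} → ι))ᵀ := by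
  ext b a
  simp [entry_symm₅ hQ (a : ι) (b : ι)]

omit [Fintype ι] [DecidableEq ι] in
/-- Re-indexed boundary-first, `Q` is the block matrix `[[Q_αα, Q_αβ], [Q_αβᵀ, Q_ββ]]`. [folklore] -/
private theorem submatrix_sumCompl_eq_fromBlocks₅ (p : ι → Prop) [DecidablePred p]
    {Q : Matrix ι ι ℝ} (hQ : Q.IsHermitian) :
    Q.submatrix (Equiv.sumCompl p) (Equiv.sumCompl p)
      = Matrix.fromBlocks (Q.submatrix (Subtype.val : {v : ι // p v} → ι) (Subtype.val : {v : ι // p v} → ι)) (Q.submatrix (Subtype.val : {v : ι // p v} → ι) (Subtype.val : {v : ι // ¬ (p v)} → ι))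
          (Q.submatrix (Subtype.val : {v : ι // p v} → ι) (Subtype.val : {v : ι // ¬ (p v)} → ι))ᵀ (Q.submatrix (Subtype.val : {v : ι // ¬ (p v)} → ι) (Subtype.val : {v : ι // ¬ (p v)} → ι)) := by
  ext (a | b) (a' | b')
  · simp
  · simp
  · simp [entry_symm₅ hQ (a' : ι) (b : ι)]
  · simp

omit [DecidableEq ι] in
/-- `Q` applied to the zero-extension of an interior vector, read anywhere. [folklore] -/
private theorem mulVec_zeroExt (p : ι → Prop) [DecidablePred p] (Q : Matrix ι ι ℝ)
    (y : {i // ¬ p i} → ℝ) (i : ι) :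
    (Q *ᵥ fun j => if h : p j then 0 else y ⟨j, h⟩) i = ∑ b : {j // ¬ p j}, Q i b * y b := by
  simp only [mulVec, dotProduct]
  rw [← Fintype.sum_subtype_add_sum_subtype p]
  have h0 : ∑ a : {j // p j}, Q i a * (if h : p a.1 then 0 else y ⟨a.1, h⟩) = 0 :=
    Finset.sum_eq_zero fun a _ => by simp [dif_pos a.2]
  rw [h0, zero_add]
  exact Finset.sum_congr rfl fun b _ => by simp [dif_neg b.2]

/-- ★★ **THE KRON-REDUCED MATRIX ACTS ON THE BOUNDARY VALUES OF HARMONIC VECTORS** («Gaussian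
elimination of the interior voltages `V_β` … gives … the reduced current-balances
`I_α + Q_ac I_β = Q_red V_α` … In case that `I_β` is the vector of zeros, the `(i,j)`-element of
`Q_red` is the current at boundary node `i` due to a unit potential at boundary node `j` and a zero
potential at all other boundary nodes»): if `Q` is symmetric with `Q_ββ ≻ 0` and `(Qz)_b = 0` at
every interior node `b` (no interior current injections), then `(Q_red z|α)_a = (Qz)_a` at every
boundary node `a`.
[cite: DorflerBullo2013, §1 eq. (reduced current-balances) `I_α + Q_ac I_β = Q_red V_α` with `I_β = 0` (arXiv:1102.2950 p0003 L38–L53)] -/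
theorem kronReduced_mulVec_of_harmonic (p : ι → Prop) [DecidablePred p] {Q : Matrix ι ι ℝ}
    (hQ : Q.IsHermitian) (hC : (Q.submatrix (Subtype.val : {v : ι // ¬ (p v)} → ι) (Subtype.val : {v : ι // ¬ (p v)} → ι)).PosDef) {z : ι → ℝ}
    (hharm : ∀ b : {i // ¬ p i}, (Q *ᵥ z) b = 0) (a : {i // p i}) :
    ((Q.submatrix (Subtype.val : {v : ι // p v} → ι) (Subtype.val : {v : ι // p v} → ι)
        - Q.submatrix (Subtype.val : {v : ι // p v} → ι) (Subtype.val : {v : ι // ¬ (p v)} → ι)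
          * (Q.submatrix (Subtype.val : {v : ι // ¬ (p v)} → ι) (Subtype.val : {v : ι // ¬ (p v)} → ι))⁻¹
          * Q.submatrix (Subtype.val : {v : ι // ¬ (p v)} → ι) (Subtype.val : {v : ι // p v} → ι)) *ᵥ (fun a : {i // p i} => z a)) a = (Q *ᵥ z) a := by
  set e := Equiv.sumCompl p with he
  set x : {i // p i} → ℝ := fun a => z a with hx
  set y : {i // ¬ p i} → ℝ := fun b => z b with hy
  -- `Q z` in block coordinates
  have hblock : ∀ s, (Q *ᵥ z) (e s)
      = (Matrix.fromBlocks (Q.submatrix (Subtype.val : {v : ι // p v} → ι) (Subtype.val : {v : ι // p v} → ι)) (Q.submatrix (Subtype.val : {v : ι // p v} → ι) (Subtype.val : {v : ι // ¬ (p v)} → ι))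
          (Q.submatrix (Subtype.val : {v : ι // p v} → ι) (Subtype.val : {v : ι // ¬ (p v)} → ι))ᵀ (Q.submatrix (Subtype.val : {v : ι // ¬ (p v)} → ι) (Subtype.val : {v : ι // ¬ (p v)} → ι)) *ᵥ Sum.elim x y) s := by
    intro s
    have h1 := congrFun (Matrix.submatrix_mulVec_equiv Q (z ∘ ⇑e) ⇑e e) s
    have hzz : (z ∘ ⇑e) ∘ ⇑e.symm = z := by ext i; simp
    have hze : z ∘ ⇑e = Sum.elim x y := by
      ext (a | b) <;> simp [he, hx, hy, Equiv.sumCompl_apply_inl, Equiv.sumCompl_apply_inr]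
    rw [hzz, submatrix_sumCompl_eq_fromBlocks₅ p hQ, hze] at h1
    exact h1.symm
  -- interior equations: `Bᵀ x + C y = 0`, so `y = −C⁻¹ Bᵀ x`
  have hint : (Q.submatrix (Subtype.val : {v : ι // p v} → ι) (Subtype.val : {v : ι // ¬ (p v)} → ι))ᵀ *ᵥ x + (Q.submatrix (Subtype.val : {v : ι // ¬ (p v)} → ι) (Subtype.val : {v : ι // ¬ (p v)} → ι)) *ᵥ y = 0 := by
    funext b
    have h1 := hblock (Sum.inr b)
    rw [Matrix.fromBlocks_mulVec] at h1
    simp only [Sum.elim_inr, Sum.elim_comp_inl, Sum.elim_comp_inr] at h1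
    have h2 := hharm b
    have h3 : (e (Sum.inr b) : ι) = (b : ι) := by simp [he]
    rw [h3] at h1
    rw [h1] at h2
    simpa using h2
  have hCu : IsUnit (Q.submatrix (Subtype.val : {v : ι // ¬ (p v)} → ι) (Subtype.val : {v : ι // ¬ (p v)} → ι)).det :=
    (Matrix.isUnit_iff_isUnit_det _).1 hC.isUnit
  have hyx : y = -((Q.submatrix (Subtype.val : {v : ι // ¬ (p v)} → ι) (Subtype.val : {v : ι // ¬ (p v)} → ι))⁻¹ *ᵥ ((Q.submatrix (Subtype.val : {v : ι // p v} → ι) (Subtype.val : {v : ι // ¬ (p v)} → ι))ᵀ *ᵥ x)) := by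
    have h1 : (Q.submatrix (Subtype.val : {v : ι // ¬ (p v)} → ι) (Subtype.val : {v : ι // ¬ (p v)} → ι)) *ᵥ y = -((Q.submatrix (Subtype.val : {v : ι // p v} → ι) (Subtype.val : {v : ι // ¬ (p v)} → ι))ᵀ *ᵥ x) :=
      eq_neg_of_add_eq_zero_right hint
    have h2 := congrArg (fun v => (Q.submatrix (Subtype.val : {v : ι // ¬ (p v)} → ι) (Subtype.val : {v : ι // ¬ (p v)} → ι))⁻¹ *ᵥ v) h1
    simp only [Matrix.mulVec_mulVec, Matrix.nonsing_inv_mul _ hCu, Matrix.one_mulVec,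
      Matrix.mulVec_neg] at h2
    simpa only [Matrix.mulVec_mulVec] using h2
  -- boundary equations
  have h1 := hblock (Sum.inl a)
  rw [Matrix.fromBlocks_mulVec] at h1
  simp only [Sum.elim_inl, Sum.elim_comp_inl, Sum.elim_comp_inr] at h1
  have h3 : (e (Sum.inl a) : ι) = (a : ι) := by simp [he]
  rw [h3] at h1
  rw [h1, hyx, submatrix_swap_eq_transpose₅ p hQ, Matrix.sub_mulVec, Matrix.mulVec_neg,
    Matrix.mulVec_mulVec, Matrix.mulVec_mulVec, sub_eq_add_neg]

/-- **Grounded solve**: with node `c` grounded (`v_c = 0`) and `v = Q_c⁻¹ w` elsewhere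
(`Q_c` = `Q` without row and column `c`, assumed `≻ 0`), `(Qv)_i = w_i` for `i ≠ c`, and for a
symmetric `Q` with zero row sums `(Qv)_c = −Σ_i w_i` (Kirchhoff). [folklore] -/
private theorem mulVec_groundedSolve {Q : Matrix ι ι ℝ} (hQ : Q.IsHermitian)
    (hrow0 : ∀ i, ∑ j, Q i j = 0) (c : ι)
    (hC : (Q.submatrix (Subtype.val : {i // ¬ (i = c)} → ι) (Subtype.val : {i // ¬ (i = c)} → ι)).PosDef)
    (w : {i // ¬ (i = c)} → ℝ) :
    (∀ (i : ι) (h : ¬ (i = c)),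
        (Q *ᵥ fun j => if hj : j = c then 0
          else ((Q.submatrix (Subtype.val : {i // ¬ (i = c)} → ι) (Subtype.val : {i // ¬ (i = c)} → ι))⁻¹ *ᵥ w) ⟨j, hj⟩) i
          = w ⟨i, h⟩)
    ∧ (Q *ᵥ fun j => if hj : j = c then 0
          else ((Q.submatrix (Subtype.val : {i // ¬ (i = c)} → ι) (Subtype.val : {i // ¬ (i = c)} → ι))⁻¹ *ᵥ w) ⟨j, hj⟩) c
        = -∑ s, w s := by
  set C := Q.submatrix (Subtype.val : {i // ¬ (i = c)} → ι) (Subtype.val : {i // ¬ (i = c)} → ι) with hCdef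
  have hCu : IsUnit C.det := (Matrix.isUnit_iff_isUnit_det _).1 hC.isUnit
  have hoff : ∀ (i : ι) (h : ¬ (i = c)),
      (Q *ᵥ fun j => if hj : j = c then 0 else (C⁻¹ *ᵥ w) ⟨j, hj⟩) i = w ⟨i, h⟩ := by
    intro i h
    rw [mulVec_zeroExt (fun j => j = c) Q (C⁻¹ *ᵥ w) i]
    have h1 : ∑ b : {j // ¬ (j = c)}, Q i b * (C⁻¹ *ᵥ w) b = ((C * C⁻¹) *ᵥ w) ⟨i, h⟩ := by
      rw [← Matrix.mulVec_mulVec]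
      simp only [mulVec, dotProduct, hCdef, Matrix.submatrix_apply]
    rw [h1, Matrix.mul_nonsing_inv _ hCu, Matrix.one_mulVec]
  refine ⟨hoff, ?_⟩
  -- Kirchhoff: the entries of `Q v` sum to zero (column sums of `Q` vanish)
  set v : ι → ℝ := fun j => if hj : j = c then 0 else (C⁻¹ *ᵥ w) ⟨j, hj⟩ with hv
  have hsum : ∑ i, (Q *ᵥ v) i = 0 := by
    simp only [mulVec, dotProduct]
    rw [Finset.sum_comm]
    refine Finset.sum_eq_zero fun j _ => ?_
    rw [← Finset.sum_mul]
    have : ∑ i, Q i j = 0 := by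
      rw [show ∑ i, Q i j = ∑ i, Q j i from Finset.sum_congr rfl fun i _ => entry_symm₅ hQ j i]
      exact hrow0 j
    rw [this, zero_mul]
  have hsplit : ∑ i, (Q *ᵥ v) i = (Q *ᵥ v) c + ∑ s : {i // ¬ (i = c)}, (Q *ᵥ v) s := by
    rw [← Finset.add_sum_erase Finset.univ (fun i => (Q *ᵥ v) i) (Finset.mem_univ c)]
    congr 1
    exact Finset.sum_subtype (Finset.univ.erase c) (fun i => by simp [Finset.mem_erase])
      (fun i => (Q *ᵥ v) i)
  have hrest : ∑ s : {i // ¬ (i = c)}, (Q *ᵥ v) s = ∑ s : {i // ¬ (i = c)}, w s :=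
    Finset.sum_congr rfl fun s _ => by rw [hoff (s : ι) s.2]
  rw [hsplit, hrest] at hsum
  linarith

end Harmonic


/-! ### §2. Uniform two-terminal couplings force a uniform complete Kron-reduced network
(Theorem 3.12, loop-less case, 1) ⇒ 2)) -/

section Uniform

variable {ι : Type*} [Fintype ι] [DecidableEq ι]

/-- ★ **Kron reduction only depends on the boundary SET**: pointwise-equivalent boundary predicates
give the same reduced matrix (re-indexed along the identity of the underlying nodes). [folklore]
(bookkeeping for the predicate form) [cite: DorflerBullo2013, §2.1 («the Kron-reduced matrix `Q_red = Q/Q(α,α)`», a function of the node subset `α`) (arXiv:1102.2950 p0007 L16–L22)] -/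
theorem kronReduced_congr (p p' : ι → Prop) [DecidablePred p] [DecidablePred p']
    (h : ∀ i, p i ↔ p' i) (Q : Matrix ι ι ℝ) :
    (Q.submatrix (Subtype.val : {v : ι // p v} → ι) (Subtype.val : {v : ι // p v} → ι)
        - Q.submatrix (Subtype.val : {v : ι // p v} → ι) (Subtype.val : {v : ι // ¬ (p v)} → ι)
          * (Q.submatrix (Subtype.val : {v : ι // ¬ (p v)} → ι) (Subtype.val : {v : ι // ¬ (p v)} → ι))⁻¹
          * Q.submatrix (Subtype.val : {v : ι // ¬ (p v)} → ι) (Subtype.val : {v : ι // p v} → ι))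
      = ((Q.submatrix (Subtype.val : {v : ι // p' v} → ι) (Subtype.val : {v : ι // p' v} → ι)
        - Q.submatrix (Subtype.val : {v : ι // p' v} → ι) (Subtype.val : {v : ι // ¬ (p' v)} → ι)
          * (Q.submatrix (Subtype.val : {v : ι // ¬ (p' v)} → ι) (Subtype.val : {v : ι // ¬ (p' v)} → ι))⁻¹
          * Q.submatrix (Subtype.val : {v : ι // ¬ (p' v)} → ι) (Subtype.val : {v : ι // p' v} → ι))).submatrix
          (fun a : {i // p i} => (⟨(a : ι), (h a).1 a.2⟩ : {i // p' i}))
          (fun a : {i // p i} => (⟨(a : ι), (h a).1 a.2⟩ : {i // p' i})) := by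
  let e : {i // p i} ≃ {i // p' i} := Equiv.subtypeEquivRight h
  let eI : {i // ¬ p i} ≃ {i // ¬ p' i} := Equiv.subtypeEquivRight fun i => not_congr (h i)
  have he : (fun a : {i // p i} => (⟨(a : ι), (h a).1 a.2⟩ : {i // p' i})) = ⇑e := rfl
  have hAA : Q.submatrix (Subtype.val : {i // p i} → ι) (Subtype.val : {i // p i} → ι)
      = (Q.submatrix (Subtype.val : {i // p' i} → ι) (Subtype.val : {i // p' i} → ι)).submatrix
          ⇑e ⇑e := by ext a b; rfl
  have hAB : Q.submatrix (Subtype.val : {i // p i} → ι) (Subtype.val : {i // ¬ p i} → ι)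
      = (Q.submatrix (Subtype.val : {i // p' i} → ι) (Subtype.val : {i // ¬ p' i} → ι)).submatrix
          ⇑e ⇑eI := by ext a b; rfl
  have hBB : Q.submatrix (Subtype.val : {i // ¬ p i} → ι) (Subtype.val : {i // ¬ p i} → ι)
      = (Q.submatrix (Subtype.val : {i // ¬ p' i} → ι) (Subtype.val : {i // ¬ p' i} → ι)).submatrix
          ⇑eI ⇑eI := by ext a b; rfl
  have hBA : Q.submatrix (Subtype.val : {i // ¬ p i} → ι) (Subtype.val : {i // p i} → ι)
      = (Q.submatrix (Subtype.val : {i // ¬ p' i} → ι) (Subtype.val : {i // p' i} → ι)).submatrix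
          ⇑eI ⇑e := by ext a b; rfl
  rw [he, hAA, hAB, hBB, hBA, Matrix.inv_submatrix_equiv, Matrix.submatrix_mul_equiv,
    Matrix.submatrix_mul_equiv]
  rfl

/-- On a two-point index type, a matrix with zero row sum at `tu` acts by
`(Kx)_{tu} = K_{tu,tv}(x_{tv} − x_{tu})`. [folklore] -/
private theorem pair_mulVec {T : Type*} [Fintype T] [DecidableEq T] (K : Matrix T T ℝ)
    (tu tv : T) (h2 : ∀ t, t = tu ∨ t = tv) (hne : tu ≠ tv) (hrow : ∑ t, K tu t = 0)
    (x : T → ℝ) : (K *ᵥ x) tu = K tu tv * (x tv - x tu) := by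
  have h1 : (K *ᵥ x) tu = ∑ t, K tu t * (x t - x tu) := by
    simp only [mulVec, dotProduct, mul_sub, Finset.sum_sub_distrib, ← Finset.sum_mul, hrow,
      zero_mul, sub_zero]
  rw [h1, Finset.sum_eq_single tv]
  · intro t _ ht
    rcases h2 t with rfl | rfl
    · ring
    · exact absurd rfl ht
  · intro h; exact absurd (Finset.mem_univ tv) h

/-- ★★★ **THEOREM 3.12, loop-less case, 1) ⇒ 2): UNIFORM EFFECTIVE RESISTANCES AMONG THE BOUNDARY
NODES FORCE A UNIFORM COMPLETE KRON-REDUCED NETWORK, `a = 2/(|α| r)`** («The effective resistances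
among the boundary nodes `α` are uniform, i.e., there is `r > 0` such that `R_ij = r` for all
distinct `i, j ∈ α` ⟺ the weighting of the edges in the Kron-reduced network is uniform, i.e.,
there is `a > 0` such that `A_red[i,j] = a` for all distinct `i,j ∈ α`. If both statements 1) and
2) are true, then it holds that `r = 2/(|α| a)`»).  Typed with the effective resistance between
boundary nodes `a ≠ b` entering through the two-terminal Kron reduction onto `{a, b}` — whose
mutual entry is `−1/R_ab` (`neg_kronReduced_pair_eq_effectiveConductance` of
`KronReductionEffectiveResistance`): if `Q` is a loop-less Laplacian of a connected graph
(symmetric, `Q_ij ≤ 0` off the diagonal, zero row sums) and every two-terminal reduction onto a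
pair of boundary nodes has mutual entry `−κ`, then every mutual entry of the Kron reduction onto
the boundary `α = q` equals `−2κ/|α|`.  Proof (not the source's pseudo-inverse computation): ground
a third boundary node `c`; with `G = (Q_red)_c⁻¹` the two-terminal data give `κ G_uu = 1` and
`κ(G_uu + G_vv − 2G_uv) = 1` (the Kron reduction acting on grounded potentials —
`kronReduced_mulVec_of_harmonic` — and the quotient property), so `G = (I + J)/(2κ)`, hence
`(Q_red)_c (I + J) = 2κ I`: all mutual entries of a row of `Q_red` coincide and the zero row sum
fixes them.
[cite: DorflerBullo2013, §3.3 Theorem 3.12 loop-less case 1) ⟺ 2) with `r = 2/(|α| a)` (arXiv:1102.2950 p0018 L53–L64), proof sketch after Lemma 3.14 (p0019 L80)] -/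
theorem kronReduced_offDiag_eq_of_pairCoupling_eq (q : ι → Prop) [DecidablePred q]
    {Q : Matrix ι ι ℝ}
    (hQ : Q.IsHermitian) (hZ : ∀ i j, i ≠ j → Q i j ≤ 0) (hrow0 : ∀ i, ∑ j, Q i j = 0)
    {G : SimpleGraph ι} (hG : ∀ i j, G.Adj i j ↔ i ≠ j ∧ Q i j ≠ 0) (hconn : G.Connected)
    {κ : ℝ}
    (hunif : ∀ (a b : ι), q a → q b → a ≠ b →
      -((Q.submatrix (Subtype.val : {v : ι // v = a ∨ v = b} → ι) (Subtype.val : {v : ι // v = a ∨ v = b} → ι)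
        - Q.submatrix (Subtype.val : {v : ι // v = a ∨ v = b} → ι) (Subtype.val : {v : ι // ¬ (v = a ∨ v = b)} → ι)
          * (Q.submatrix (Subtype.val : {v : ι // ¬ (v = a ∨ v = b)} → ι) (Subtype.val : {v : ι // ¬ (v = a ∨ v = b)} → ι))⁻¹
          * Q.submatrix (Subtype.val : {v : ι // ¬ (v = a ∨ v = b)} → ι) (Subtype.val : {v : ι // v = a ∨ v = b} → ι)) ⟨a, Or.inl rfl⟩ ⟨b, Or.inr rfl⟩) = κ)
    {a b : ι} (ha : q a) (hb : q b) (hab : a ≠ b) :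
    (Q.submatrix (Subtype.val : {v : ι // q v} → ι) (Subtype.val : {v : ι // q v} → ι)
        - Q.submatrix (Subtype.val : {v : ι // q v} → ι) (Subtype.val : {v : ι // ¬ (q v)} → ι)
          * (Q.submatrix (Subtype.val : {v : ι // ¬ (q v)} → ι) (Subtype.val : {v : ι // ¬ (q v)} → ι))⁻¹
          * Q.submatrix (Subtype.val : {v : ι // ¬ (q v)} → ι) (Subtype.val : {v : ι // q v} → ι)) ⟨a, ha⟩ ⟨b, hb⟩ = -(2 * κ / (Finset.univ.filter q).card) := by
  have hα : ∃ i, q i := ⟨a, ha⟩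
  have hrow : ∀ i, 0 ≤ ∑ j, Q i j := fun i => (hrow0 i).symm.le
  -- the case `α = {a, b}`
  by_cases h3 : ∃ c, q c ∧ c ≠ a ∧ c ≠ b
  swap
  · have hq2 : ∀ i, q i ↔ (i = a ∨ i = b) := by
      intro i
      constructor
      · intro hi
        by_contra hne
        rw [not_or] at hne
        exact h3 ⟨i, hi, hne.1, hne.2⟩
      · rintro (rfl | rfl) <;> assumption
    have hcard : Fintype.card {i // q i} = 2 := by
      rw [Fintype.card_congr (Equiv.subtypeEquivRight hq2),
        Fintype.card_of_subtype ({a, b} : Finset ι) (fun x => by simp), Finset.card_pair hab]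
    rw [kronReduced_congr q (fun i => i = a ∨ i = b) hq2 Q, Matrix.submatrix_apply,
      ← Fintype.card_subtype q, hcard]
    have h := hunif a b ha hb hab
    push_cast
    linarith
  obtain ⟨c, hc, hca, hcb⟩ := h3
  -- the reduced matrix and its Laplacian package
  set M := (Q.submatrix (Subtype.val : {v : ι // q v} → ι) (Subtype.val : {v : ι // q v} → ι)
        - Q.submatrix (Subtype.val : {v : ι // q v} → ι) (Subtype.val : {v : ι // ¬ (q v)} → ι)
          * (Q.submatrix (Subtype.val : {v : ι // ¬ (q v)} → ι) (Subtype.val : {v : ι // ¬ (q v)} → ι))⁻¹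
          * Q.submatrix (Subtype.val : {v : ι // ¬ (q v)} → ι) (Subtype.val : {v : ι // q v} → ι)) with hM
  have hMh : M.IsHermitian := by rw [hM]; exact isHermitian_kronReduced q hQ
  have hMZ : ∀ y y' : {i // q i}, y ≠ y' → M y y' ≤ 0 := fun y y' h => by
    rw [hM]; exact kronReduced_offDiag_nonpos q hQ hZ hrow hG hconn hα h
  have hMrow0 : ∀ y : {i // q i}, ∑ y', M y y' = 0 := fun y => by
    rw [hM]; exact kronReduced_rowsum_eq_zero q hQ hZ hrow0 hG hconn hα y
  have hMrow : ∀ y : {i // q i}, 0 ≤ ∑ y', M y y' := fun y => (hMrow0 y).symm.le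
  have hMsymm : ∀ y y' : {i // q i}, M y' y = M y y' := entry_symm₅ hMh
  set GM : SimpleGraph {i // q i} := SimpleGraph.fromRel fun y y' => M y y' ≠ 0 with hGMdef
  have hGM : ∀ y y', GM.Adj y y' ↔ y ≠ y' ∧ M y y' ≠ 0 := by
    intro y y'
    rw [hGMdef, SimpleGraph.fromRel_adj, hMsymm y y', or_self]
  have hMconn : GM.Connected := by
    refine kronReduced_connected q hQ hZ hrow hG hconn hα (Gr := GM) ?_
    intro y y'; rw [hGM, hM]
  -- ground the third boundary node `c`
  set ya : {i // q i} := ⟨a, ha⟩ with hya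
  set yb : {i // q i} := ⟨b, hb⟩ with hyb
  set yc : {i // q i} := ⟨c, hc⟩ with hyc
  have hCc : (M.submatrix (Subtype.val : {y : {i // q i} // ¬ (y = yc)} → {i // q i}) (Subtype.val : {y : {i // q i} // ¬ (y = yc)} → {i // q i})).PosDef :=
    interiorBlock_posDef_of_laplacian (fun y => y = yc) hMh hMZ hMrow hGM hMconn ⟨yc, rfl⟩
  set Gc := (M.submatrix (Subtype.val : {y : {i // q i} // ¬ (y = yc)} → {i // q i}) (Subtype.val : {y : {i // q i} // ¬ (y = yc)} → {i // q i}))⁻¹ with hGc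
  have hGh : Gc.IsHermitian := (hMh.submatrix _).inv
  have hGsymm : ∀ s s' : {y : {i // q i} // ¬ (y = yc)}, Gc s' s = Gc s s' := entry_symm₅ hGh
  -- CORE: `M` acting on a vector that is harmonic off `{u, t}` reads `κ (z_u − z_t)` at `u`
  have core : ∀ (u t : {i // q i}) (hut : u ≠ t) (z : {i // q i} → ℝ),
      (∀ y : {i // q i}, y ≠ u → y ≠ t → (M *ᵥ z) y = 0) →
      (M *ᵥ z) u = κ * (z u - z t) := by
    intro u t hut z hharm
    have hut' : (u : ι) ≠ (t : ι) := fun h => hut (Subtype.ext h)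
    have hus : (u : ι) = (u : ι) ∨ (u : ι) = (t : ι) := Or.inl rfl
    have hts : (t : ι) = (u : ι) ∨ (t : ι) = (t : ι) := Or.inr rfl
    have hpq : ∀ i, (i = (u : ι) ∨ i = (t : ι)) → q i := by
      rintro i (rfl | rfl)
      · exact u.2
      · exact t.2
    have h2 : ∀ s : {y : {i // q i} // (y : ι) = (u : ι) ∨ (y : ι) = (t : ι)},
        s = ⟨u, hus⟩ ∨ s = ⟨t, hts⟩ := by
      intro s
      rcases s.2 with h | h
      · exact Or.inl (Subtype.ext (Subtype.ext h))
      · exact Or.inr (Subtype.ext (Subtype.ext h))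
    have hne : (⟨u, hus⟩ : {y : {i // q i} // (y : ι) = (u : ι) ∨ (y : ι) = (t : ι)}) ≠ ⟨t, hts⟩ :=
      fun h => hut (congrArg Subtype.val h)
    have hCs := interiorBlock_posDef_of_laplacian
      (fun y : {i // q i} => (y : ι) = (u : ι) ∨ (y : ι) = (t : ι)) hMh hMZ hMrow hGM hMconn
      ⟨u, hus⟩
    have hharm' : ∀ y : {y : {i // q i} // ¬ ((y : ι) = (u : ι) ∨ (y : ι) = (t : ι))},
        (M *ᵥ z) y = 0 := by
      intro y
      have hy := y.2
      rw [not_or] at hy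
      exact hharm y (fun h => hy.1 (congrArg Subtype.val h))
        (fun h => hy.2 (congrArg Subtype.val h))
    -- Kron reduction acts on the boundary data of the harmonic vector `z`
    have hL1 := kronReduced_mulVec_of_harmonic
      (fun y : {i // q i} => (y : ι) = (u : ι) ∨ (y : ι) = (t : ι)) hMh hCs hharm' ⟨u, hus⟩
    -- the two-terminal reduction of `M` is the two-terminal reduction of `Q` (quotient property)
    have hD := interiorBlock_posDef_of_laplacian
      (fun i => i = (u : ι) ∨ i = (t : ι)) hQ hZ hrow hG hconn ⟨u, hus⟩
    have hquot := kronReduced_kronReduced (fun i => i = (u : ι) ∨ i = (t : ι)) q hpq hQ hD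
    rw [← hM] at hquot
    have hKut := congrFun (congrFun hquot ⟨u, hus⟩) ⟨t, hts⟩
    rw [Matrix.submatrix_apply] at hKut
    dsimp only at hKut
    have hunif' := hunif (u : ι) (t : ι) u.2 t.2 hut'
    -- zero row sum of the two-terminal reduction of `M`
    have hrowK := kronReduced_rowsum_eq_zero
      (fun y : {i // q i} => (y : ι) = (u : ι) ∨ (y : ι) = (t : ι)) hMh hMZ hMrow0 hGM
      hMconn ⟨u, hus⟩ ⟨u, hus⟩
    have hpair := pair_mulVec _ _ _ h2 hne hrowK (fun s => z s)
    have e1 := hL1.symm.trans hpair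
    rw [hKut] at e1
    dsimp only at e1
    linear_combination e1 + (z u - z t) * hunif'
  -- P1: `κ G_uu = 1`
  have P1 : ∀ (u : {i // q i}) (hu : ¬ (u = yc)), κ * Gc ⟨u, hu⟩ ⟨u, hu⟩ = 1 := by
    intro u hu
    set w : {y : {i // q i} // ¬ (y = yc)} → ℝ := Pi.single ⟨u, hu⟩ 1 with hw
    obtain ⟨hoff, hcrow⟩ := mulVec_groundedSolve hMh hMrow0 yc hCc w
    rw [← hGc] at hoff hcrow
    set z : {i // q i} → ℝ := fun y => if hy : y = yc then 0 else (Gc *ᵥ w) ⟨y, hy⟩ with hz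
    have hzu : z u = Gc ⟨u, hu⟩ ⟨u, hu⟩ := by
      show (if hy : u = yc then 0 else (Gc *ᵥ w) ⟨u, hy⟩) = _
      rw [dif_neg hu, hw, Matrix.mulVec_single_one, Matrix.col_apply]
    have hzc : z yc = 0 := by
      show (if hy : yc = yc then 0 else (Gc *ᵥ w) ⟨yc, hy⟩) = _
      rw [dif_pos rfl]
    have hMzu : (M *ᵥ z) u = 1 := by rw [hoff u hu, hw, Pi.single_eq_same]
    have hc' := core u yc hu z (fun y hyu hyy => by
      rw [hoff y hyy, hw]
      exact Pi.single_eq_of_ne (fun h => hyu (congrArg Subtype.val h)) _)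
    rw [hMzu, hzu, hzc, sub_zero] at hc'
    exact hc'.symm
  -- P2: `κ (G_uu + G_vv − 2 G_uv) = 1`
  have P2 : ∀ (u v : {i // q i}) (hu : ¬ (u = yc)) (hv : ¬ (v = yc)), u ≠ v →
      κ * (Gc ⟨u, hu⟩ ⟨u, hu⟩ + Gc ⟨v, hv⟩ ⟨v, hv⟩ - 2 * Gc ⟨u, hu⟩ ⟨v, hv⟩) = 1 := by
    intro u v hu hv huv
    have huv' : (⟨u, hu⟩ : {y : {i // q i} // ¬ (y = yc)}) ≠ ⟨v, hv⟩ :=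
      fun h => huv (congrArg Subtype.val h)
    set w : {y : {i // q i} // ¬ (y = yc)} → ℝ := Pi.single ⟨u, hu⟩ 1 - Pi.single ⟨v, hv⟩ 1
      with hw
    obtain ⟨hoff, hcrow⟩ := mulVec_groundedSolve hMh hMrow0 yc hCc w
    rw [← hGc] at hoff hcrow
    set z : {i // q i} → ℝ := fun y => if hy : y = yc then 0 else (Gc *ᵥ w) ⟨y, hy⟩ with hz
    have hGw : ∀ s, (Gc *ᵥ w) s = Gc s ⟨u, hu⟩ - Gc s ⟨v, hv⟩ := by
      intro s
      rw [hw, Matrix.mulVec_sub, Pi.sub_apply, Matrix.mulVec_single_one, Matrix.mulVec_single_one,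
        Matrix.col_apply, Matrix.col_apply]
    have hzu : z u = Gc ⟨u, hu⟩ ⟨u, hu⟩ - Gc ⟨u, hu⟩ ⟨v, hv⟩ := by
      show (if hy : u = yc then 0 else (Gc *ᵥ w) ⟨u, hy⟩) = _
      rw [dif_neg hu]; exact hGw _
    have hzv : z v = Gc ⟨u, hu⟩ ⟨v, hv⟩ - Gc ⟨v, hv⟩ ⟨v, hv⟩ := by
      show (if hy : v = yc then 0 else (Gc *ᵥ w) ⟨v, hy⟩) = _
      rw [dif_neg hv, hGw, hGsymm ⟨u, hu⟩ ⟨v, hv⟩]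
    have hsumw : ∑ s, w s = 0 := by
      rw [hw]; simp [Finset.sum_sub_distrib, Finset.sum_pi_single']
    have hMzu : (M *ᵥ z) u = 1 := by
      rw [hoff u hu, hw, Pi.sub_apply, Pi.single_eq_same, Pi.single_eq_of_ne huv', sub_zero]
    have hc' := core u v huv z (fun y hyu hyv => by
      by_cases hyy : y = yc
      · rw [hyy, hcrow, hsumw, neg_zero]
      · rw [hoff y hyy, hw, Pi.sub_apply,
          Pi.single_eq_of_ne (fun h => hyu (congrArg Subtype.val h)) _,
          Pi.single_eq_of_ne (fun h => hyv (congrArg Subtype.val h)) _, sub_zero])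
    rw [hMzu, hzu, hzv] at hc'
    linear_combination (-1 : ℝ) * hc'
  -- hence `κ ≠ 0`, `κ G_uu = 1`, `2κ G_uv = 1`
  have hyac : ¬ (ya = yc) := fun h => hca (congrArg Subtype.val h).symm
  have hκ : κ ≠ 0 := by
    intro h0; have h1 := P1 ya hyac; rw [h0, zero_mul] at h1; exact zero_ne_one h1
  have hGoff : ∀ (u v : {i // q i}) (hu : ¬ (u = yc)) (hv : ¬ (v = yc)), u ≠ v →
      2 * κ * Gc ⟨u, hu⟩ ⟨v, hv⟩ = 1 := by
    intro u v hu hv huv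
    have h1 := P1 u hu; have h2 := P1 v hv; have h3 := P2 u v hu hv huv
    linarith
  -- `(Q_red)_c · G = I`, read in the row of `a`
  have hCu : IsUnit (M.submatrix (Subtype.val : {y : {i // q i} // ¬ (y = yc)} → {i // q i}) (Subtype.val : {y : {i // q i} // ¬ (y = yc)} → {i // q i})).det :=
    (Matrix.isUnit_iff_isUnit_det _).1 hCc.isUnit
  have hMG := Matrix.mul_nonsing_inv _ hCu
  rw [← hGc] at hMG
  -- the row sum of `M` at `ya` without the `c` term
  have hsplit : ∑ s : {y : {i // q i} // ¬ (y = yc)}, M ya s = -M ya yc := by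
    have h1 : ∑ y, M ya y = M ya yc + ∑ s : {y : {i // q i} // ¬ (y = yc)}, M ya s := by
      rw [← Finset.add_sum_erase Finset.univ (fun y => M ya y) (Finset.mem_univ yc)]
      congr 1
      exact Finset.sum_subtype (Finset.univ.erase yc) (fun i => by simp [Finset.mem_erase])
        (fun y => M ya y)
    have h2 := hMrow0 ya
    linarith
  -- row `a` of `(Q_red)_c · G`, column `t`
  have hrowexp : ∀ t : {y : {i // q i} // ¬ (y = yc)},
      ∑ s, M.submatrix (Subtype.val : {y : {i // q i} // ¬ (y = yc)} → {i // q i}) (Subtype.val : {y : {i // q i} // ¬ (y = yc)} → {i // q i}) ⟨ya, hyac⟩ s * Gc s t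
        = (1 / (2 * κ)) * (M ya t - M ya yc) := by
    intro t
    have hGt : ∀ s : {y : {i // q i} // ¬ (y = yc)},
        Gc s t = 1 / (2 * κ) + (if s = t then 1 / (2 * κ) else 0) := by
      intro s
      by_cases hst : s = t
      · rw [hst, if_pos rfl]
        have h1 := P1 (t : {i // q i}) t.2
        simp only [Subtype.coe_eta] at h1
        field_simp
        linarith
      · rw [if_neg hst, add_zero]
        have h1 := hGoff (s : {i // q i}) (t : {i // q i}) s.2 t.2
          (fun h => hst (Subtype.ext h))
        simp only [Subtype.coe_eta] at h1
        field_simp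
        linarith
    have h2 : ∀ s : {y : {i // q i} // ¬ (y = yc)},
        M.submatrix (Subtype.val : {y : {i // q i} // ¬ (y = yc)} → {i // q i}) (Subtype.val : {y : {i // q i} // ¬ (y = yc)} → {i // q i}) ⟨ya, hyac⟩ s * Gc s t
          = (1 / (2 * κ)) * M ya s + (if s = t then (1 / (2 * κ)) * M ya t else 0) := by
      intro s
      rw [Matrix.submatrix_apply, hGt s]
      by_cases hst : s = t
      · rw [if_pos hst, if_pos hst, hst]; ring
      · rw [if_neg hst, if_neg hst]; ring
    rw [Finset.sum_congr rfl (fun s _ => h2 s), Finset.sum_add_distrib, Finset.sum_ite_eq',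
      if_pos (Finset.mem_univ _), ← Finset.mul_sum, hsplit]
    ring
  have h2κ : (1 : ℝ) / (2 * κ) ≠ 0 := one_div_ne_zero (mul_ne_zero two_ne_zero hκ)
  -- all mutual entries of the row of `a` coincide …
  have hoffeq : ∀ y : {i // q i}, y ≠ ya → M ya y = M ya yc := by
    intro y hy
    by_cases hyy : y = yc
    · rw [hyy]
    · have h1 := congrFun (congrFun hMG ⟨ya, hyac⟩) ⟨y, hyy⟩
      rw [Matrix.mul_apply, hrowexp,
        Matrix.one_apply_ne (fun h => hy (congrArg Subtype.val h).symm)] at h1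
      rcases mul_eq_zero.1 h1 with h | h
      · exact absurd h h2κ
      · linarith
  -- … and differ from the diagonal entry by `2κ`
  have hdiag : M ya ya - M ya yc = 2 * κ := by
    have h1 := congrFun (congrFun hMG ⟨ya, hyac⟩) ⟨ya, hyac⟩
    rw [Matrix.mul_apply, hrowexp, Matrix.one_apply_eq] at h1
    field_simp at h1
    linarith
  -- count with the zero row sum
  have hApos : 0 < Fintype.card {i // q i} := Fintype.card_pos_iff.2 ⟨ya⟩
  have hn : (Fintype.card {i // q i} : ℝ) ≠ 0 := Nat.cast_ne_zero.2 hApos.ne'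
  have hcount : ∑ y, M ya y = M ya ya + ((Fintype.card {i // q i} : ℝ) - 1) * M ya yc := by
    rw [← Finset.add_sum_erase Finset.univ (fun y => M ya y) (Finset.mem_univ ya)]
    congr 1
    rw [Finset.sum_congr rfl (fun y hy => hoffeq y (Finset.ne_of_mem_erase hy)), Finset.sum_const,
      nsmul_eq_mul, Finset.card_erase_of_mem (Finset.mem_univ ya), Finset.card_univ,
      Nat.cast_sub (Nat.succ_le_of_lt hApos)]
    push_cast
    ring
  have h0 := hMrow0 ya
  rw [hcount] at h0
  have key : (Fintype.card {i // q i} : ℝ) * M ya yc = -(2 * κ) := by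
    linear_combination h0 - hdiag
  have hba : yb ≠ ya := fun h => hab (congrArg Subtype.val h).symm
  rw [hoffeq yb hba, ← Fintype.card_subtype q]
  field_simp
  linear_combination key

end Uniform

/-! ### §3. The converse (Theorem 3.12, loop-less case, 2) ⇒ 1)): a uniform complete network has
uniform two-terminal couplings `|α| a / 2` -/

section Converse

variable {ι : Type*} [Fintype ι] [DecidableEq ι]

/-- ★★ **A UNIFORM COMPLETE LAPLACIAN HAS TWO-TERMINAL COUPLINGS `n a/2`** (the computation behind
Theorem 3.12 2) ⇒ 1), `r = 2/(|α| a)`): if `M` has all mutual entries `−a` (`a > 0`) and zero row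
sums on `n` nodes, then the Kron reduction of `M` onto any pair `{u, t}` has mutual entry `−n a/2`
(the vector `e_u − e_t` is harmonic off `{u, t}`, and `(M(e_u − e_t))_u = n a`).
[cite: DorflerBullo2013, §3.3 Theorem 3.12 loop-less case, 2) ⇒ 1) with `r = 2/(|α| a)` (arXiv:1102.2950 p0018 L53–L64); Lemma 3.14 (uniform Laplacian matrices) (p0019 L12–L17)] -/
theorem pairCoupling_of_offDiag_eq {M : Matrix ι ι ℝ} {w : ℝ} (hw : 0 < w)
    (hoff : ∀ i j, i ≠ j → M i j = -w) (hrow0 : ∀ i, ∑ j, M i j = 0) {u t : ι} (hut : u ≠ t) :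
    -((M.submatrix (Subtype.val : {v : ι // v = u ∨ v = t} → ι) (Subtype.val : {v : ι // v = u ∨ v = t} → ι)
        - M.submatrix (Subtype.val : {v : ι // v = u ∨ v = t} → ι) (Subtype.val : {v : ι // ¬ (v = u ∨ v = t)} → ι)
          * (M.submatrix (Subtype.val : {v : ι // ¬ (v = u ∨ v = t)} → ι) (Subtype.val : {v : ι // ¬ (v = u ∨ v = t)} → ι))⁻¹
          * M.submatrix (Subtype.val : {v : ι // ¬ (v = u ∨ v = t)} → ι) (Subtype.val : {v : ι // v = u ∨ v = t} → ι)) ⟨u, Or.inl rfl⟩ ⟨t, Or.inr rfl⟩)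
      = Fintype.card ι * w / 2 := by
  -- the Laplacian package of `M` (complete graph)
  have hMh : M.IsHermitian := by
    refine Matrix.IsHermitian.ext fun i j => ?_
    simp only [star_trivial]
    by_cases h : i = j
    · rw [h]
    · rw [hoff j i (Ne.symm h), hoff i j h]
  have hZ : ∀ i j, i ≠ j → M i j ≤ 0 := fun i j h => by rw [hoff i j h]; linarith
  have hrow : ∀ i, 0 ≤ ∑ j, M i j := fun i => (hrow0 i).symm.le
  haveI : Nonempty ι := ⟨u⟩
  have hG : ∀ i j, (⊤ : SimpleGraph ι).Adj i j ↔ i ≠ j ∧ M i j ≠ 0 := by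
    intro i j
    rw [SimpleGraph.top_adj]
    constructor
    · intro h; exact ⟨h, by rw [hoff i j h]; linarith⟩
    · exact fun h => h.1
  have hconn : (⊤ : SimpleGraph ι).Connected := SimpleGraph.connected_top
  have hus : u = u ∨ u = t := Or.inl rfl
  have hts : t = u ∨ t = t := Or.inr rfl
  have hCs := interiorBlock_posDef_of_laplacian (fun i => i = u ∨ i = t) hMh hZ hrow hG hconn
    ⟨u, hus⟩
  -- diagonal entries from the zero row sums: `M_uu = (n − 1) a`
  have hdiag : M u u = (Fintype.card ι - 1) * w := by
    have h1 := hrow0 u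
    rw [← Finset.add_sum_erase Finset.univ (fun j => M u j) (Finset.mem_univ u),
      Finset.sum_congr rfl (fun j hj => hoff u j (Finset.ne_of_mem_erase hj).symm), Finset.sum_const,
      nsmul_eq_mul, Finset.card_erase_of_mem (Finset.mem_univ u), Finset.card_univ,
      Nat.cast_sub (Nat.succ_le_of_lt (Fintype.card_pos_iff.2 ⟨u⟩))] at h1
    push_cast at h1
    linarith
  -- the harmonic vector `e_u − e_t`
  set z : ι → ℝ := Pi.single u 1 - Pi.single t 1 with hz
  have hMz : ∀ i, (M *ᵥ z) i = M i u - M i t := by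
    intro i
    rw [hz, Matrix.mulVec_sub, Pi.sub_apply, Matrix.mulVec_single_one, Matrix.mulVec_single_one,
      Matrix.col_apply, Matrix.col_apply]
  have hharm : ∀ y : {i // ¬ (i = u ∨ i = t)}, (M *ᵥ z) y = 0 := by
    intro y
    have hy := y.2
    rw [not_or] at hy
    rw [hMz, hoff _ _ hy.1, hoff _ _ hy.2, sub_self]
  have hL1 := kronReduced_mulVec_of_harmonic (fun i => i = u ∨ i = t) hMh hCs hharm ⟨u, hus⟩
  rw [hMz, hdiag, hoff u t hut] at hL1
  -- zero row sum of the two-terminal reduction: apply the same to the constant vector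
  have hharm1 : ∀ y : {i // ¬ (i = u ∨ i = t)}, (M *ᵥ fun _ => (1 : ℝ)) y = 0 := by
    intro y
    have : (M *ᵥ fun _ => (1 : ℝ)) y = ∑ j, M y j := by simp [mulVec, dotProduct]
    rw [this, hrow0]
  have hK1 := kronReduced_mulVec_of_harmonic (fun i => i = u ∨ i = t) hMh hCs hharm1 ⟨u, hus⟩
  have hrowK : ∑ s, (M.submatrix (Subtype.val : {v : ι // v = u ∨ v = t} → ι) (Subtype.val : {v : ι // v = u ∨ v = t} → ι)
        - M.submatrix (Subtype.val : {v : ι // v = u ∨ v = t} → ι) (Subtype.val : {v : ι // ¬ (v = u ∨ v = t)} → ι)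
          * (M.submatrix (Subtype.val : {v : ι // ¬ (v = u ∨ v = t)} → ι) (Subtype.val : {v : ι // ¬ (v = u ∨ v = t)} → ι))⁻¹
          * M.submatrix (Subtype.val : {v : ι // ¬ (v = u ∨ v = t)} → ι) (Subtype.val : {v : ι // v = u ∨ v = t} → ι)) ⟨u, hus⟩ s = 0 := by
    have h1 : (M *ᵥ fun _ => (1 : ℝ)) u = 0 := by
      have : (M *ᵥ fun _ => (1 : ℝ)) u = ∑ j, M u j := by simp [mulVec, dotProduct]
      rw [this, hrow0]
    rw [h1] at hK1
    simpa [mulVec, dotProduct] using hK1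
  have h2 : ∀ s : {i // i = u ∨ i = t}, s = ⟨u, hus⟩ ∨ s = ⟨t, hts⟩ := by
    intro s
    rcases s.2 with h | h
    · exact Or.inl (Subtype.ext h)
    · exact Or.inr (Subtype.ext h)
  have hne : (⟨u, hus⟩ : {i // i = u ∨ i = t}) ≠ ⟨t, hts⟩ := fun h => hut (congrArg Subtype.val h)
  have hpair := pair_mulVec _ _ _ h2 hne hrowK (fun s => z s)
  rw [hpair] at hL1
  have hzu : z u = 1 := by
    rw [hz, Pi.sub_apply, Pi.single_eq_same, Pi.single_eq_of_ne hut, sub_zero]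
  have hzt : z t = -1 := by
    rw [hz, Pi.sub_apply, Pi.single_eq_same, Pi.single_eq_of_ne (Ne.symm hut), zero_sub]
  dsimp only at hL1
  rw [hzu, hzt] at hL1
  linarith

/-- The Laplacian package of a Kron reduction of a loop-less Laplacian of a connected graph
(collecting `KronReductionClosure`): symmetric, mutual entries `≤ 0`, zero row sums, connected
graph of non-zero mutual entries. [folklore] -/
private theorem kronReduced_package (q : ι → Prop) [DecidablePred q] {Q : Matrix ι ι ℝ}
    (hQ : Q.IsHermitian) (hZ : ∀ i j, i ≠ j → Q i j ≤ 0) (hrow0 : ∀ i, ∑ j, Q i j = 0)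
    {G : SimpleGraph ι} (hG : ∀ i j, G.Adj i j ↔ i ≠ j ∧ Q i j ≠ 0) (hconn : G.Connected)
    (hα : ∃ i, q i) :
    ((Q.submatrix (Subtype.val : {v : ι // q v} → ι) (Subtype.val : {v : ι // q v} → ι)
        - Q.submatrix (Subtype.val : {v : ι // q v} → ι) (Subtype.val : {v : ι // ¬ (q v)} → ι)
          * (Q.submatrix (Subtype.val : {v : ι // ¬ (q v)} → ι) (Subtype.val : {v : ι // ¬ (q v)} → ι))⁻¹
          * Q.submatrix (Subtype.val : {v : ι // ¬ (q v)} → ι) (Subtype.val : {v : ι // q v} → ι))).IsHermitian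
    ∧ (∀ y y' : {i // q i}, y ≠ y' → (Q.submatrix (Subtype.val : {v : ι // q v} → ι) (Subtype.val : {v : ι // q v} → ι)
        - Q.submatrix (Subtype.val : {v : ι // q v} → ι) (Subtype.val : {v : ι // ¬ (q v)} → ι)
          * (Q.submatrix (Subtype.val : {v : ι // ¬ (q v)} → ι) (Subtype.val : {v : ι // ¬ (q v)} → ι))⁻¹
          * Q.submatrix (Subtype.val : {v : ι // ¬ (q v)} → ι) (Subtype.val : {v : ι // q v} → ι)) y y' ≤ 0)
    ∧ (∀ y : {i // q i}, ∑ y', (Q.submatrix (Subtype.val : {v : ι // q v} → ι) (Subtype.val : {v : ι // q v} → ι)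
        - Q.submatrix (Subtype.val : {v : ι // q v} → ι) (Subtype.val : {v : ι // ¬ (q v)} → ι)
          * (Q.submatrix (Subtype.val : {v : ι // ¬ (q v)} → ι) (Subtype.val : {v : ι // ¬ (q v)} → ι))⁻¹
          * Q.submatrix (Subtype.val : {v : ι // ¬ (q v)} → ι) (Subtype.val : {v : ι // q v} → ι)) y y' = 0)
    ∧ ∃ GM : SimpleGraph {i // q i}, (∀ y y', GM.Adj y y' ↔ y ≠ y' ∧ (Q.submatrix (Subtype.val : {v : ι // q v} → ι) (Subtype.val : {v : ι // q v} → ι)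
        - Q.submatrix (Subtype.val : {v : ι // q v} → ι) (Subtype.val : {v : ι // ¬ (q v)} → ι)
          * (Q.submatrix (Subtype.val : {v : ι // ¬ (q v)} → ι) (Subtype.val : {v : ι // ¬ (q v)} → ι))⁻¹
          * Q.submatrix (Subtype.val : {v : ι // ¬ (q v)} → ι) (Subtype.val : {v : ι // q v} → ι)) y y' ≠ 0)
        ∧ GM.Connected := by
  set M := (Q.submatrix (Subtype.val : {v : ι // q v} → ι) (Subtype.val : {v : ι // q v} → ι)
        - Q.submatrix (Subtype.val : {v : ι // q v} → ι) (Subtype.val : {v : ι // ¬ (q v)} → ι)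
          * (Q.submatrix (Subtype.val : {v : ι // ¬ (q v)} → ι) (Subtype.val : {v : ι // ¬ (q v)} → ι))⁻¹
          * Q.submatrix (Subtype.val : {v : ι // ¬ (q v)} → ι) (Subtype.val : {v : ι // q v} → ι)) with hM
  have hrow : ∀ i, 0 ≤ ∑ j, Q i j := fun i => (hrow0 i).symm.le
  have hMh : M.IsHermitian := by rw [hM]; exact isHermitian_kronReduced q hQ
  have hMsymm : ∀ y y' : {i // q i}, M y' y = M y y' := entry_symm₅ hMh
  refine ⟨hMh, fun y y' h => ?_, fun y => ?_, SimpleGraph.fromRel fun y y' => M y y' ≠ 0, ?_, ?_⟩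
  · rw [hM]; exact kronReduced_offDiag_nonpos q hQ hZ hrow hG hconn hα h
  · rw [hM]; exact kronReduced_rowsum_eq_zero q hQ hZ hrow0 hG hconn hα y
  · intro y y'
    rw [SimpleGraph.fromRel_adj, hMsymm y y', or_self]
  · refine kronReduced_connected q hQ hZ hrow hG hconn hα ?_
    intro y y'
    rw [SimpleGraph.fromRel_adj, hMsymm y y', or_self, hM]

/-- ★★★ **THEOREM 3.12, loop-less case, 2) ⇒ 1)**: if the Kron reduction of a loop-less Laplacian
of a connected graph onto the boundary `α` is the uniform complete network with mutual entries
`−a` (`a > 0`), then every two-terminal reduction onto a pair of boundary nodes has mutual entry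
`−|α| a/2` — i.e. all boundary effective resistances equal `r = 2/(|α| a)` (with
`neg_kronReduced_pair_eq_effectiveConductance`).
[cite: DorflerBullo2013, §3.3 Theorem 3.12 loop-less case 2) ⇒ 1), `r = 2/(|α| a)` (arXiv:1102.2950 p0018 L53–L64)] -/
theorem pairCoupling_eq_of_kronReduced_offDiag_eq (q : ι → Prop) [DecidablePred q]
    {Q : Matrix ι ι ℝ}
    (hQ : Q.IsHermitian) (hZ : ∀ i j, i ≠ j → Q i j ≤ 0) (hrow0 : ∀ i, ∑ j, Q i j = 0)
    {G : SimpleGraph ι} (hG : ∀ i j, G.Adj i j ↔ i ≠ j ∧ Q i j ≠ 0) (hconn : G.Connected)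
    {w : ℝ} (hw : 0 < w)
    (hoffA : ∀ y y' : {i // q i}, y ≠ y' → (Q.submatrix (Subtype.val : {v : ι // q v} → ι) (Subtype.val : {v : ι // q v} → ι)
        - Q.submatrix (Subtype.val : {v : ι // q v} → ι) (Subtype.val : {v : ι // ¬ (q v)} → ι)
          * (Q.submatrix (Subtype.val : {v : ι // ¬ (q v)} → ι) (Subtype.val : {v : ι // ¬ (q v)} → ι))⁻¹
          * Q.submatrix (Subtype.val : {v : ι // ¬ (q v)} → ι) (Subtype.val : {v : ι // q v} → ι)) y y' = -w)
    {a b : ι} (ha : q a) (hb : q b) (hab : a ≠ b) :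
    -((Q.submatrix (Subtype.val : {v : ι // v = a ∨ v = b} → ι) (Subtype.val : {v : ι // v = a ∨ v = b} → ι)
        - Q.submatrix (Subtype.val : {v : ι // v = a ∨ v = b} → ι) (Subtype.val : {v : ι // ¬ (v = a ∨ v = b)} → ι)
          * (Q.submatrix (Subtype.val : {v : ι // ¬ (v = a ∨ v = b)} → ι) (Subtype.val : {v : ι // ¬ (v = a ∨ v = b)} → ι))⁻¹
          * Q.submatrix (Subtype.val : {v : ι // ¬ (v = a ∨ v = b)} → ι) (Subtype.val : {v : ι // v = a ∨ v = b} → ι)) ⟨a, Or.inl rfl⟩ ⟨b, Or.inr rfl⟩)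
      = (Finset.univ.filter q).card * w / 2 := by
  obtain ⟨hMh, -, hMrow0, -⟩ := kronReduced_package q hQ hZ hrow0 hG hconn ⟨a, ha⟩
  set M := (Q.submatrix (Subtype.val : {v : ι // q v} → ι) (Subtype.val : {v : ι // q v} → ι)
        - Q.submatrix (Subtype.val : {v : ι // q v} → ι) (Subtype.val : {v : ι // ¬ (q v)} → ι)
          * (Q.submatrix (Subtype.val : {v : ι // ¬ (q v)} → ι) (Subtype.val : {v : ι // ¬ (q v)} → ι))⁻¹
          * Q.submatrix (Subtype.val : {v : ι // ¬ (q v)} → ι) (Subtype.val : {v : ι // q v} → ι)) with hM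
  have hrow : ∀ i, 0 ≤ ∑ j, Q i j := fun i => (hrow0 i).symm.le
  set ya : {i // q i} := ⟨a, ha⟩ with hya
  set yb : {i // q i} := ⟨b, hb⟩ with hyb
  have hyab : ya ≠ yb := fun h => hab (congrArg Subtype.val h)
  -- the two-terminal reduction of `M` onto `{a, b}` (computed by `pairCoupling_of_offDiag_eq`) …
  have hT2 := pairCoupling_of_offDiag_eq (M := M) hw hoffA hMrow0 hyab
  -- … is the two-terminal reduction of `Q` (quotient property + re-indexing of the pair predicate)
  have hpq : ∀ i, (i = a ∨ i = b) → q i := by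
    rintro i (rfl | rfl)
    · exact ha
    · exact hb
  have hD := interiorBlock_posDef_of_laplacian (fun i => i = a ∨ i = b) hQ hZ hrow hG hconn
    ⟨a, Or.inl rfl⟩
  have hquot := kronReduced_kronReduced (fun i => i = a ∨ i = b) q hpq hQ hD
  rw [← hM] at hquot
  have hiff : ∀ y : {i // q i}, (y = ya ∨ y = yb) ↔ ((y : ι) = a ∨ (y : ι) = b) := by
    intro y
    constructor
    · rintro (h | h)
      · exact Or.inl (congrArg Subtype.val h)
      · exact Or.inr (congrArg Subtype.val h)
    · rintro (h | h)
      · exact Or.inl (Subtype.ext h)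
      · exact Or.inr (Subtype.ext h)
  have hcongr := kronReduced_congr (fun y : {i // q i} => y = ya ∨ y = yb)
    (fun y : {i // q i} => (y : ι) = a ∨ (y : ι) = b) hiff M
  have h1 := congrFun (congrFun hcongr ⟨ya, Or.inl rfl⟩) ⟨yb, Or.inr rfl⟩
  rw [Matrix.submatrix_apply] at h1
  dsimp only at h1
  have h2 := congrFun (congrFun hquot ⟨ya, Or.inl rfl⟩) ⟨yb, Or.inr rfl⟩
  rw [Matrix.submatrix_apply] at h2
  dsimp only at h2
  rw [h1, h2, Fintype.card_subtype q] at hT2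
  exact hT2

end Converse

end KronReduction

/-! ### §4. THE MODEL: electrically uniform generator sets reduce EXACTLY to the all-to-all
uniform coupling (Dörfler–Bullo §2.6 resistive synchronization condition, Remark 3.13) -/

namespace ClassicalModel

open KronReduction Literature.Probability.MarkovChains

variable {X : Type*} [Fintype X] [DecidableEq X] {c : Matrix X X ℝ}

/-- The susceptance Laplacian `diag(c(x)) − c` of a conductance matrix: symmetric, mutual entries
`≤ 0`, zero row sums, same graph. [folklore] -/
private theorem laplacian_package (hc : IsConductance c) {G : SimpleGraph X}
    (hG : ∀ x y, G.Adj x y ↔ x ≠ y ∧ c x y ≠ 0) :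
    (Matrix.diagonal (nodeConductance c) - c).IsHermitian
    ∧ (∀ x y, x ≠ y → (Matrix.diagonal (nodeConductance c) - c) x y ≤ 0)
    ∧ (∀ x, ∑ y, (Matrix.diagonal (nodeConductance c) - c) x y = 0)
    ∧ (∀ x y, G.Adj x y ↔ x ≠ y ∧ (Matrix.diagonal (nodeConductance c) - c) x y ≠ 0) := by
  refine ⟨?_, fun x y h => ?_, fun x => ?_, fun x y => ?_⟩
  · refine Matrix.IsHermitian.ext fun x y => ?_
    rw [star_trivial, Matrix.sub_apply, Matrix.sub_apply, hc.1 y x]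
    by_cases h : x = y
    · rw [h]
    · rw [Matrix.diagonal_apply_ne _ h, Matrix.diagonal_apply_ne _ (Ne.symm h)]
  · rw [Matrix.sub_apply, Matrix.diagonal_apply_ne _ h, zero_sub, neg_nonpos]
    exact hc.2.1 x y
  · rw [Finset.sum_congr rfl fun y _ => Matrix.sub_apply _ _ x y, Finset.sum_sub_distrib]
    simp only [Matrix.diagonal_apply, Finset.sum_ite_eq, Finset.mem_univ, if_true]
    rw [nodeConductance]
    ring
  · rw [hG]
    constructor
    · rintro ⟨hne, h⟩
      exact ⟨hne, by rwa [Matrix.sub_apply, Matrix.diagonal_apply_ne _ hne, zero_sub, neg_ne_zero]⟩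
    · rintro ⟨hne, h⟩
      refine ⟨hne, ?_⟩
      rwa [Matrix.sub_apply, Matrix.diagonal_apply_ne _ hne, zero_sub, neg_ne_zero] at h

/-- ★★★ **ELECTRICALLY UNIFORM GENERATORS SEE THE ALL-TO-ALL UNIFORM COUPLING — EXACTLY** (Theorem
3.12 1) ⇒ 2) read on the power network; «if the effective resistance among all generators takes
the uniform value `R` … the element-wise condition on `|α| min_{i≠j}{P_ij}` in the reduced network
[becomes] a resistive synchronization condition `1/R > …` in the non-reduced network», «The
assumption of uniform effective resistances … corresponds to an ideal network, where all boundary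
[nodes] are electrically uniformly distributed»).  Nodes `X` = generator internal nodes and buses,
`c` the line / transformer / transient-reactance susceptances (symmetric, `≥ 0`, every node on a
line, NO shunts), bus graph connected, `B = diag(c(x)) − c`, generators = `A`.  If every pair of
distinct generators `a, z ∈ A` has the same effective reactance `𝓧_c(a ↔ z) = r` through the whole
network, then EVERY network-reduced coupling is the same:
`|V_a||V_z|(−B_red[a,z]) = |V_a||V_z| · 2/(|A| r)` — the network-reduced classical model is the
COMPLETE graph with uniform weights, i.e. (for uniform `|V|`) exactly the all-to-all uniformly
coupled model of the tree's complete-graph synchronization theorems.  CERTIFIED: kernel identity;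
MODELLED: lossless, shunt-free, classical machines, `|V|` fixed.
[cite: DorflerBullo2013, §3.3 Theorem 3.12 loop-less case with `r = 2/(|α| a)` and Remark 3.13 (arXiv:1102.2950 p0018 L53–L64, p0019 L5–L8); §2.6 resistive synchronization condition `1/R > …` (p0010 L57–L68)] -/
theorem kronCoupling_eq_of_effectiveResistance_eq (hc : IsConductance c) {G : SimpleGraph X}
    (hG : ∀ x y, G.Adj x y ↔ x ≠ y ∧ c x y ≠ 0) (hconn : G.Connected) (A : Finset X) {r : ℝ}
    (hunifR : ∀ a z, a ∈ A → z ∈ A → a ≠ z → effectiveResistance c a z = r)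
    (V : X → ℝ) {a z : X} (ha : a ∈ A) (hz : z ∈ A) (haz : a ≠ z) :
    V a * V z * -(((Matrix.diagonal (nodeConductance c) - c).submatrix (Subtype.val : {v : X // v ∈ A} → X) (Subtype.val : {v : X // v ∈ A} → X)
        - (Matrix.diagonal (nodeConductance c) - c).submatrix (Subtype.val : {v : X // v ∈ A} → X) (Subtype.val : {v : X // ¬ (v ∈ A)} → X)
          * ((Matrix.diagonal (nodeConductance c) - c).submatrix (Subtype.val : {v : X // ¬ (v ∈ A)} → X) (Subtype.val : {v : X // ¬ (v ∈ A)} → X))⁻¹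
          * (Matrix.diagonal (nodeConductance c) - c).submatrix (Subtype.val : {v : X // ¬ (v ∈ A)} → X) (Subtype.val : {v : X // v ∈ A} → X)) ⟨a, ha⟩ ⟨z, hz⟩)
      = V a * V z * (2 / (A.card * r)) := by
  obtain ⟨hL, hZ, hrow0, hGL⟩ := laplacian_package hc hG
  have hirr := isIrreducible_networkKernel_of_connected hc hG hconn
  -- two-terminal couplings = effective conductances = `1/r`, in predicate form
  have hunif : ∀ (a b : X), a ∈ A → b ∈ A → a ≠ b →
      -(((Matrix.diagonal (nodeConductance c) - c).submatrix (Subtype.val : {v : X // v = a ∨ v = b} → X) (Subtype.val : {v : X // v = a ∨ v = b} → X)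
          - (Matrix.diagonal (nodeConductance c) - c).submatrix (Subtype.val : {v : X // v = a ∨ v = b} → X) (Subtype.val : {v : X // ¬ (v = a ∨ v = b)} → X)
            * ((Matrix.diagonal (nodeConductance c) - c).submatrix (Subtype.val : {v : X // ¬ (v = a ∨ v = b)} → X) (Subtype.val : {v : X // ¬ (v = a ∨ v = b)} → X))⁻¹
            * (Matrix.diagonal (nodeConductance c) - c).submatrix (Subtype.val : {v : X // ¬ (v = a ∨ v = b)} → X) (Subtype.val : {v : X // v = a ∨ v = b} → X)) ⟨a, Or.inl rfl⟩ ⟨b, Or.inr rfl⟩) = 1 / r := by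
    intro a b ha hb hab
    have hiff : ∀ x, (x = a ∨ x = b) ↔ x ∈ ({a, b} : Finset X) := fun x => by simp
    have hcg := kronReduced_congr (fun x => x = a ∨ x = b) (fun x => x ∈ ({a, b} : Finset X))
      hiff (Matrix.diagonal (nodeConductance c) - c)
    have h1 := congrFun (congrFun hcg ⟨a, Or.inl rfl⟩) ⟨b, Or.inr rfl⟩
    rw [Matrix.submatrix_apply] at h1
    dsimp only at h1
    rw [h1, neg_kronReduced_pair_eq_effectiveConductance hc hirr hab rfl
      ((hiff a).1 (Or.inl rfl)) ((hiff b).1 (Or.inr rfl)), hunifR a b ha hb hab]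
  have hT1 := kronReduced_offDiag_eq_of_pairCoupling_eq (fun x => x ∈ A) hL hZ hrow0 hGL hconn
    hunif ha hz haz
  rw [hT1, Finset.filter_univ_mem A]
  ring

/-- ★★★ **… AND CONVERSELY: a uniform complete network-reduced model means electrically uniform
generators** (Theorem 3.12 2) ⇒ 1) on the power network): if all network-reduced couplings
`−B_red[a,z]` (`a ≠ z ∈ A`) equal `w > 0`, then every pair of generators has effective reactance
`𝓧_c(a ↔ z) = 2/(|A| w)` through the network.
[cite: DorflerBullo2013, §3.3 Theorem 3.12 loop-less case 2) ⇒ 1), `r = 2/(|α| a)` (arXiv:1102.2950 p0018 L53–L64)] -/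
theorem effectiveResistance_eq_of_kronCoupling_eq (hc : IsConductance c) {G : SimpleGraph X}
    (hG : ∀ x y, G.Adj x y ↔ x ≠ y ∧ c x y ≠ 0) (hconn : G.Connected) (A : Finset X) {w : ℝ}
    (hw : 0 < w)
    (hunifK : ∀ a z : {x // x ∈ A}, a ≠ z →
      -(((Matrix.diagonal (nodeConductance c) - c).submatrix (Subtype.val : {v : X // v ∈ A} → X) (Subtype.val : {v : X // v ∈ A} → X)
        - (Matrix.diagonal (nodeConductance c) - c).submatrix (Subtype.val : {v : X // v ∈ A} → X) (Subtype.val : {v : X // ¬ (v ∈ A)} → X)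
          * ((Matrix.diagonal (nodeConductance c) - c).submatrix (Subtype.val : {v : X // ¬ (v ∈ A)} → X) (Subtype.val : {v : X // ¬ (v ∈ A)} → X))⁻¹
          * (Matrix.diagonal (nodeConductance c) - c).submatrix (Subtype.val : {v : X // ¬ (v ∈ A)} → X) (Subtype.val : {v : X // v ∈ A} → X)) a z) = w)
    {a z : X} (ha : a ∈ A) (hz : z ∈ A) (haz : a ≠ z) :
    effectiveResistance c a z = 2 / (A.card * w) := by
  obtain ⟨hL, hZ, hrow0, hGL⟩ := laplacian_package hc hG
  have hirr := isIrreducible_networkKernel_of_connected hc hG hconn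
  have hoffA : ∀ y y' : {x // x ∈ A}, y ≠ y' →
      ((Matrix.diagonal (nodeConductance c) - c).submatrix (Subtype.val : {v : X // v ∈ A} → X) (Subtype.val : {v : X // v ∈ A} → X)
        - (Matrix.diagonal (nodeConductance c) - c).submatrix (Subtype.val : {v : X // v ∈ A} → X) (Subtype.val : {v : X // ¬ (v ∈ A)} → X)
          * ((Matrix.diagonal (nodeConductance c) - c).submatrix (Subtype.val : {v : X // ¬ (v ∈ A)} → X) (Subtype.val : {v : X // ¬ (v ∈ A)} → X))⁻¹
          * (Matrix.diagonal (nodeConductance c) - c).submatrix (Subtype.val : {v : X // ¬ (v ∈ A)} → X) (Subtype.val : {v : X // v ∈ A} → X)) y y' = -w := fun y y' h => by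
    have := hunifK y y' h; linarith
  have hT2 := pairCoupling_eq_of_kronReduced_offDiag_eq (fun x => x ∈ A) hL hZ hrow0 hGL hconn hw
    hoffA ha hz haz
  -- the two-terminal coupling is the effective conductance
  have hiff : ∀ x, (x = a ∨ x = z) ↔ x ∈ ({a, z} : Finset X) := fun x => by simp
  have hcg := kronReduced_congr (fun x => x = a ∨ x = z) (fun x => x ∈ ({a, z} : Finset X))
    hiff (Matrix.diagonal (nodeConductance c) - c)
  have h1 := congrFun (congrFun hcg ⟨a, Or.inl rfl⟩) ⟨z, Or.inr rfl⟩
  rw [Matrix.submatrix_apply] at h1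
  dsimp only at h1
  rw [h1, neg_kronReduced_pair_eq_effectiveConductance hc hirr haz rfl
    ((hiff a).1 (Or.inl rfl)) ((hiff z).1 (Or.inr rfl)), Finset.filter_univ_mem A] at hT2
  -- `1/𝓡 = |A| w / 2`
  have hR : effectiveResistance c a z = 1 / ((A.card : ℝ) * w / 2) := by
    rw [← hT2, one_div_one_div]
  rw [hR]
  have : (0 : ℝ) < A.card := Nat.cast_pos.2 (Finset.card_pos.2 ⟨a, ha⟩)
  field_simp

end ClassicalModel

end Literature.MathematicalPhysics.PowerSystems
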